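import Summits.Ventures.LatticeQCDFlow.Scaling.SimulatedTemperingFiniteGap

/-!
HONEST FRAMING: exact (Metropolis-corrected) sampling algorithms for lattice gauge theory; figures
of merit are autocorrelation/cost numbers at stated couplings and volumes; no continuum-physics
claim.

# SimulatedTemperingColdEstimator — THE STATISTICAL PRICE OF A COLD-LEVEL EXPECTATION BY TEMPERING: the cold-visit
# numerator `g(k,x) = 1{k = K}·(h(x) − E_{μ_K}h)` has `E_π g = 0`, `Var_π(g) = Var_{μ_K}(h)/(K+1)`, and for every gap floor
# `c ≤ Gap(stFinSampler t μ M)`: `asympVar(g) ≤ (2/c − 1)·Var_{μ_K}(h)/(K+1)` (lean-2 GEN-17, ours)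

Venture-side (OURS).  Cell `lqcd-flow` (pub-lqcd), unit `pub-lqcd-lean-2-g17`, 2026-08-25.  What a tempering run
actually reports for a cold-level observable `h : S → ℝ` is the average of `h` over the COLD VISITS; its numerator is
the ergodic sum of `g(k,x) = 1{k = K}(h(x) − E_{μ_K}h)` along the sampler `stFinSampler t μ M` of
`Scaling/SimulatedTemperingFiniteSampler` (the denominator, the number of cold visits, has stationary rate `1/(K+1)`).
This file prices that numerator in the tree's asymptotic-variance currency (`AsymptoticVarianceSpectral.asympVar`,
Madras–Slade (9.2.27) `asympVar ≤ (2/γ − 1)Var`, PROVED in the Literature).  Everything is stated for an arbitrary level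
`k` (the cold level `k = K` is the case of interest; `K` in the displays).

## What is proved

* `stFin_lawMean_coldObs` — `E_π g = 0`; **`stFin_lawVariance_coldObs`** — `Var_π(g) = Var_{μ_K}(h)/(K+1)`.
* **`stFin_asympVar_coldObs_le`** — `0 < t < 1`, irreducible `μ_k`-reversible `M_k`, any `0 < c ≤ Gap(stFinSampler t μ M)`
  (chapter X / Y floors) ⇒ `asympVar(g) ≤ (2/c − 1)·Var_{μ_K}(h)/(K+1)`.
* **`stFin_asympVar_coldObs_le_sweep`** — per SWEEP of `K+1` steps (the cost of one pass over the ladder, comparable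
  to one cold update when every level costs the same): `(K+1)·asympVar(g) ≤ (2/c − 1)·Var_{μ_K}(h)` — against
  `(2/γ_K − 1)·Var_{μ_K}(h)` for `K+1`… for ONE step of a cold sampler with gap `γ_K`: tempering pays off exactly when
  its gap floor `c` per step beats the cold level's own gap `γ_K` per `K+1` steps.

NOT CLAIMED: the ratio estimator's delta-method / CLT (the tree's `BatchMeans*` files are the route); costs that differ
between levels; anything measured.  Literature grade (cell rule): ELEMENTARY, NEW TYPING; (9.2.27) imported PROVED; no new
bib keys.
-/

noncomputable section

open Finset
open Literature.Probability.MarkovChains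
open Literature.Probability.MarkovChains.Decomposition

namespace Summit.Ventures.LatticeQCDFlow.Scaling

variable {S : Type*} [Fintype S] [DecidableEq S] {K : ℕ} {μ : Fin (K + 1) → S → ℝ}
  {M : Fin (K + 1) → Matrix S S ℝ} {t : ℝ}

omit [DecidableEq S] in
/-- A level-`K`-supported observable sums over the cold slice only:
`Σ_p π(p)·1{p.1 = K}F(p) = (K+1)⁻¹Σ_y μ_K(y)F(K,y)`. [ours] -/
theorem stFin_sum_coldSlice (k : Fin (K + 1)) (F : Fin (K + 1) × S → ℝ) :
    ∑ p, stFinLaw μ p * (if p.1 = k then F p else 0) = (∑ y, μ k y * F (k, y)) / (K + 1) := by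
  have h : ∀ p : Fin (K + 1) × S, stFinLaw μ p * (if p.1 = k then F p else 0)
      = if p.1 = k then μ k p.2 * F p / (K + 1) else 0 := by
    intro p
    split_ifs with hp
    · unfold stFinLaw; rw [hp]; ring
    · rw [mul_zero]
  simp_rw [h]
  rw [sum_ite_fst_eq k (fun p => μ k p.2 * F p / (K + 1)), ← Finset.sum_div]

omit [DecidableEq S] in
/-- **The cold-visit numerator is centred:** `E_π[1{k=K}(h − E_{μ_K}h)] = 0`. [ours] -/
theorem stFin_lawMean_coldObs (hμ1 : ∀ k, ∑ x, μ k x = 1) (k : Fin (K + 1)) (h : S → ℝ) :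
    lawMean (stFinLaw μ) (fun p => if p.1 = k then h p.2 - lawMean (μ k) h else 0) = 0 := by
  unfold lawMean
  rw [stFin_sum_coldSlice k (fun p => h p.2 - ∑ x, μ k x * h x)]
  simp only
  rw [div_eq_zero_iff]
  left
  simp_rw [mul_sub, Finset.sum_sub_distrib, ← Finset.sum_mul, hμ1 k, one_mul, sub_self]

omit [DecidableEq S] in
/-- **Its stationary variance is the cold variance diluted by the level occupation:** `Var_π(g) = Var_{μ_K}(h)/(K+1)`.
[ours] -/
theorem stFin_lawVariance_coldObs (hμ1 : ∀ k, ∑ x, μ k x = 1) (k : Fin (K + 1)) (h : S → ℝ) :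
    lawVariance (stFinLaw μ) (fun p => if p.1 = k then h p.2 - lawMean (μ k) h else 0)
      = lawVariance (μ k) h / (K + 1) := by
  unfold lawVariance
  rw [stFin_lawMean_coldObs hμ1 k h]
  have hsq : ∀ p : Fin (K + 1) × S, ((if p.1 = k then h p.2 - lawMean (μ k) h else 0) - 0) ^ 2
      = if p.1 = k then (h p.2 - lawMean (μ k) h) ^ 2 else 0 := by
    intro p; split_ifs <;> ring
  simp_rw [hsq]
  exact stFin_sum_coldSlice k (fun p => (h p.2 - lawMean (μ k) h) ^ 2)

/-- **THE PRICE OF A COLD EXPECTATION BY TEMPERING:** for every gap floor `0 < c ≤ Gap(stFinSampler t μ M)` (`0 < t < 1`,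
`K ≥ 1`, irreducible `μ_k`-reversible `M_k`) and every cold observable `h`, the cold-visit numerator
`g = 1{k=K}(h − E_{μ_K}h)` has `asympVar(g) ≤ (2/c − 1)·Var_{μ_K}(h)/(K+1)`. [ours] -/
theorem stFin_asympVar_coldObs_le (hK : 1 ≤ K) (hμ : ∀ k x, 0 < μ k x) (hμ1 : ∀ k, ∑ x, μ k x = 1)
    (hM : ∀ k, IsRowStochastic (M k)) (hMrev : ∀ k, DetailedBalance (μ k) (M k))
    (hMirr : ∀ k, IsIrreducible (M k)) (ht0 : 0 < t) (ht1 : t < 1) {c : ℝ} (hc : 0 < c)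
    (hgap : c ≤ spectralGap (stFinLaw μ) (stFinSampler t μ M)) (k : Fin (K + 1)) (h : S → ℝ) :
    asympVar (fun p => if p.1 = k then h p.2 - lawMean (μ k) h else 0) (stFinLaw μ) (stFinSampler t μ M)
      ≤ (2 / c - 1) * (lawVariance (μ k) h / (K + 1)) := by
  haveI : Nonempty S := by
    by_contra hS
    rw [not_nonempty_iff] at hS
    have := hμ1 0
    rw [Finset.univ_eq_empty, Finset.sum_empty] at this
    exact zero_ne_one this
  haveI : Nontrivial (Fin (K + 1)) := Fin.nontrivial_iff_two_le.mpr (by omega)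
  have hP := stFinSampler_isRowStochastic (M := M) hμ hM ht0.le ht1.le
  have hDB := stFinSampler_detailedBalance (t := t) (M := M) hμ hMrev
  have hirr := stFinSampler_isIrreducible hμ hM hMirr ht0 ht1
  have h1 := asympVar_le_spectralGap (stFinLaw_pos hμ) (sum_stFinLaw hμ1) hP hDB hirr
    (fun p => if p.1 = k then h p.2 - lawMean (μ k) h else 0)
  rw [stFin_lawVariance_coldObs hμ1 k h] at h1
  refine h1.trans (mul_le_mul_of_nonneg_right ?_ ?_)
  · have := div_le_div_of_nonneg_left (by norm_num : (0 : ℝ) ≤ 2) hc hgap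
    linarith
  · exact div_nonneg (lawVariance_nonneg (fun x => (hμ k x).le) h) (by positivity)

/-- **PER SWEEP OF `K+1` STEPS:** `(K+1)·asympVar(g) ≤ (2/c − 1)·Var_{μ_K}(h)` — to be compared with the one-step price
`(2/γ_K − 1)·Var_{μ_K}(h)` of a cold sampler with gap `γ_K`, if it had one worth the name. [ours] -/
theorem stFin_asympVar_coldObs_le_sweep (hK : 1 ≤ K) (hμ : ∀ k x, 0 < μ k x) (hμ1 : ∀ k, ∑ x, μ k x = 1)
    (hM : ∀ k, IsRowStochastic (M k)) (hMrev : ∀ k, DetailedBalance (μ k) (M k))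
    (hMirr : ∀ k, IsIrreducible (M k)) (ht0 : 0 < t) (ht1 : t < 1) {c : ℝ} (hc : 0 < c)
    (hgap : c ≤ spectralGap (stFinLaw μ) (stFinSampler t μ M)) (k : Fin (K + 1)) (h : S → ℝ) :
    (K + 1) * asympVar (fun p => if p.1 = k then h p.2 - lawMean (μ k) h else 0) (stFinLaw μ) (stFinSampler t μ M)
      ≤ (2 / c - 1) * lawVariance (μ k) h := by
  have h1 := stFin_asympVar_coldObs_le hK hμ hμ1 hM hMrev hMirr ht0 ht1 hc hgap k h
  have hK0 : (0 : ℝ) < K + 1 := by positivity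
  calc (K + 1 : ℝ) * asympVar (fun p => if p.1 = k then h p.2 - lawMean (μ k) h else 0) (stFinLaw μ)
        (stFinSampler t μ M)
      ≤ (K + 1) * ((2 / c - 1) * (lawVariance (μ k) h / (K + 1))) := mul_le_mul_of_nonneg_left h1 hK0.le
    _ = (2 / c - 1) * lawVariance (μ k) h := by field_simp

end Summit.Ventures.LatticeQCDFlow.Scaling

end
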